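import Mathlib.Analysis.SpecialFunctions.Trigonometric.Inverse
import Mathlib.Analysis.SpecialFunctions.Trigonometric.Bounds
import Literature.Barriers.HubbardSuperconductivity.WeakCouplingCeiling
import HarnessLib

/-!
# Counting Lee–Yang zeros from the tilted mean: elementary real-analysis lemmas

Topic: `Literature/Probability/LatticeModels`. Everything here is proved; there are no
definitions and no named facts.

A Lee–Yang lattice law (C. M. Newman, Comm. Math. Phys. 41 (1975) 1–9, Prop. 2; lattice form in
`LeeYangLatticeLaw*.lean`) has `E e^{tX} = cosh^m t ∏ᵢ (1 + bᵢ sinh² t)` with `bᵢ ≥ 1`, so that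
its tilted mean is `E(X e^{tX}) / E(e^{tX}) = m tanh t + ∑ᵢ 2bᵢ sinh t cosh t / (1 + bᵢ sinh² t)`
and the zeros of `E cos(θX) = cos^m θ ∏ᵢ (1 - bᵢ sin² θ)` sit at `sin² θ = 1/bᵢ`. This file collects
the elementary estimates that turn an upper bound on the tilted mean into a lower bound on
`max bᵢ`, i.e. an upper bound on the first zero (sub-namespace `LeeYangZeroCounting`; the
inequality `sinh t ≤ t cosh t` is `sinh_le_self_mul_cosh` of
`Literature/Barriers/HubbardSuperconductivity/WeakCouplingCeiling.lean`, imported):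

* `card_filter_le_mul_of_tilted_sum_le` — the Markov-type count
  `#{i : bᵢ sinh² t ≥ 1} ≤ t · R` whenever the tilted mean at `t > 0` is `≤ R`;
* `sum_le_card_mul_add_sum_of_card_filter_le` — the dyadic layer-cake bound
  `∑_{i ∈ s} fᵢ ≤ #s · Λ₀ + ∑_{j<J} c_j Λ_{j+1}` from `#{i : Λ_j < fᵢ} ≤ c_j` and `fᵢ ≤ Λ_J`;
* `sum_range_pow_le` — `∑_{j<J} 16^j ≤ 16^J / 15`;
* `sinh_level_pos`, `sinh_level_le` — the levels `t_J = β (u₀/2^J)⁵`: `sinh t_J > 0` and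
  `sinh t_J ≤ t_J cosh (β u₀⁵)`;
* `sum_le_of_card_filter_le` — the layer cake along the levels `Λ_j = 1 / sinh² t_j` under the
  counting bound `#{i : bᵢ sinh²(βu⁵) ≥ 1} ≤ K u⁶` (`0 < u ≤ u₀`):
  `∑ bᵢ ≤ n Λ₀ + (1024 K / (15 β² u₀⁴)) 16^J` if all `bᵢ ≤ Λ_J`;
* `pow_lt_of_inv_sinh_sq_lt` — `Λ_J < B` forces `1024^J < β² u₀¹⁰ cosh²(βu₀⁵) · B`;
* `exists_le_inv_sinh_sq` — every `B` lies below some level `Λ_J`;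
* `exists_pos_sin_sq_mul_eq_one` — for `B ≥ 1` the zero `θ = arcsin (B^{-1/2})` has `θ > 0`,
  `B sin² θ = 1` and, by Jordan's inequality, `θ² B ≤ π²/4`.

All statements are folklore calculus; the exponents `5, 6, 10` encode the critical-isotherm
exponent `δ = 5` of the application (block-spin Lee–Yang zeros of the three-dimensional critical
Ising model), but the lemmas are stated for arbitrary positive parameters.
-/

noncomputable section

namespace Literature.Probability.LatticeModels

open Finset Literature.Barriers.HubbardSuperconductivity
open scoped BigOperators

namespace LeeYangZeroCounting

/-! ### Hyperbolic functions -/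

/-- The dyadic levels `t_J = β (u₀ / 2^J)⁵` are positive for `β, u₀ > 0`, hence so is
`sinh t_J`. [folklore] -/
theorem sinh_level_pos {β u₀ : ℝ} (hβ : 0 < β) (hu₀ : 0 < u₀) (J : ℕ) :
    0 < Real.sinh (β * (u₀ / 2 ^ J) ^ 5) :=
  Real.sinh_pos_iff.2 (by positivity)

/-- Along the dyadic levels `t_J = β (u₀ / 2^J)⁵ ≤ β u₀⁵`:
`sinh t_J ≤ t_J cosh t_J ≤ t_J cosh (β u₀⁵)`. [folklore] -/
theorem sinh_level_le {β u₀ : ℝ} (hβ : 0 < β) (hu₀ : 0 < u₀) (J : ℕ) :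
    Real.sinh (β * (u₀ / 2 ^ J) ^ 5) ≤ β * (u₀ / 2 ^ J) ^ 5 * Real.cosh (β * u₀ ^ 5) := by
  have hule : u₀ / 2 ^ J ≤ u₀ := div_le_self hu₀.le (one_le_pow₀ (by norm_num))
  have ht : 0 < β * (u₀ / 2 ^ J) ^ 5 := by positivity
  have ht₀ : β * (u₀ / 2 ^ J) ^ 5 ≤ β * u₀ ^ 5 := by gcongr
  have hcosh : Real.cosh (β * (u₀ / 2 ^ J) ^ 5) ≤ Real.cosh (β * u₀ ^ 5) := by
    rw [Real.cosh_le_cosh, abs_of_pos ht, abs_of_pos (lt_of_lt_of_le ht ht₀)]; exact ht₀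
  exact (sinh_le_self_mul_cosh ht.le).trans (mul_le_mul_of_nonneg_left hcosh ht.le)

/-! ### Counting large coefficients from the tilted mean -/

/-- **Markov-type count from the tilted mean.** If `bᵢ ≥ 1`, `t > 0`, `m ≥ 0` and
`m tanh t + ∑ᵢ 2bᵢ sinh t cosh t / (1 + bᵢ sinh² t) ≤ R`, then `#{i : bᵢ sinh² t ≥ 1} ≤ t R`:
every summand is `≥ 0`, and for `bᵢ sinh² t ≥ 1` it is `≥ cosh t / sinh t ≥ 1/t`. [folklore] -/
theorem card_filter_le_mul_of_tilted_sum_le {n : ℕ} (b : Fin n → ℝ) (hb : ∀ i, 1 ≤ b i)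
    {t m R : ℝ} (ht : 0 < t) (hm : 0 ≤ m)
    (h : m * Real.tanh t + ∑ i, 2 * b i * Real.sinh t * Real.cosh t / (1 + b i * Real.sinh t ^ 2)
      ≤ R) :
    ((Finset.univ.filter (fun i => 1 ≤ b i * Real.sinh t ^ 2)).card : ℝ) ≤ t * R := by
  have hs : 0 < Real.sinh t := Real.sinh_pos_iff.2 ht
  have hc : 0 < Real.cosh t := Real.cosh_pos t
  have htanh : 0 ≤ m * Real.tanh t := by
    rw [Real.tanh_eq_sinh_div_cosh]; positivity
  have hsc : Real.sinh t ≤ t * Real.cosh t := sinh_le_self_mul_cosh ht.le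
  have hterm : ∀ i, 0 ≤ 2 * b i * Real.sinh t * Real.cosh t / (1 + b i * Real.sinh t ^ 2) := by
    intro i
    have := hb i
    positivity
  have hbig : ∀ i ∈ Finset.univ.filter (fun i => 1 ≤ b i * Real.sinh t ^ 2),
      1 / t ≤ 2 * b i * Real.sinh t * Real.cosh t / (1 + b i * Real.sinh t ^ 2) := by
    intro i hi
    rw [Finset.mem_filter] at hi
    have hbi := hb i
    rw [div_le_div_iff₀ ht (by positivity)]
    nlinarith [mul_le_mul_of_nonneg_left hsc (by positivity : 0 ≤ 2 * b i * Real.sinh t), hi.2]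
  have hsum : ((Finset.univ.filter (fun i => 1 ≤ b i * Real.sinh t ^ 2)).card : ℝ) * (1 / t)
      ≤ R := by
    calc ((Finset.univ.filter (fun i => 1 ≤ b i * Real.sinh t ^ 2)).card : ℝ) * (1 / t)
        = ∑ i ∈ Finset.univ.filter (fun i => 1 ≤ b i * Real.sinh t ^ 2), 1 / t := by
          rw [Finset.sum_const, nsmul_eq_mul]
      _ ≤ ∑ i ∈ Finset.univ.filter (fun i => 1 ≤ b i * Real.sinh t ^ 2),
            2 * b i * Real.sinh t * Real.cosh t / (1 + b i * Real.sinh t ^ 2) :=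
          Finset.sum_le_sum hbig
      _ ≤ ∑ i, 2 * b i * Real.sinh t * Real.cosh t / (1 + b i * Real.sinh t ^ 2) :=
          Finset.sum_le_sum_of_subset_of_nonneg (Finset.filter_subset _ _)
            (fun i _ _ => hterm i)
      _ ≤ R := by linarith
  rwa [mul_one_div, div_le_iff₀' ht] at hsum

/-! ### The dyadic layer cake -/

/-- **Dyadic layer-cake bound.** For levels `Λ_j ≥ 0` with `#{i ∈ s : Λ_j < fᵢ} ≤ c_j` for all `j`
and `fᵢ ≤ Λ_J` on `s`: `∑_{i ∈ s} fᵢ ≤ #s · Λ₀ + ∑_{j<J} c_j Λ_{j+1}` (peel off the top shell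
`{Λ_{J-1} < fᵢ ≤ Λ_J}` and induct). [folklore] -/
theorem sum_le_card_mul_add_sum_of_card_filter_le {ι : Type*} (f : ι → ℝ) (Λ c : ℕ → ℝ)
    (hΛ : ∀ j, 0 ≤ Λ j) :
    ∀ (J : ℕ) (s : Finset ι), (∀ j, ((s.filter (fun i => Λ j < f i)).card : ℝ) ≤ c j) →
      (∀ i ∈ s, f i ≤ Λ J) →
      ∑ i ∈ s, f i ≤ s.card * Λ 0 + ∑ j ∈ Finset.range J, c j * Λ (j + 1) := by
  intro J
  induction J with
  | zero =>
    intro s _ hJ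
    simp only [Finset.range_zero, Finset.sum_empty, add_zero]
    calc ∑ i ∈ s, f i ≤ ∑ i ∈ s, Λ 0 := Finset.sum_le_sum hJ
      _ = s.card * Λ 0 := by rw [Finset.sum_const, nsmul_eq_mul]
  | succ J ih =>
    intro s hc hJ
    have hsplit := Finset.sum_filter_add_sum_filter_not s (fun i => Λ J < f i) f
    have h1 : ∑ i ∈ s.filter (fun i => ¬ Λ J < f i), f i ≤
        (s.filter (fun i => ¬ Λ J < f i)).card * Λ 0 + ∑ j ∈ range J, c j * Λ (j + 1) := by
      refine ih _ (fun j => le_trans ?_ (hc j)) (fun i hi => ?_)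
      · exact_mod_cast Finset.card_le_card
          (Finset.filter_subset_filter _ (Finset.filter_subset _ _))
      · exact not_lt.1 (Finset.mem_filter.1 hi).2
    have h2 : ∑ i ∈ s.filter (fun i => Λ J < f i), f i ≤ c J * Λ (J + 1) := by
      calc ∑ i ∈ s.filter (fun i => Λ J < f i), f i
          ≤ ∑ i ∈ s.filter (fun i => Λ J < f i), Λ (J + 1) :=
            Finset.sum_le_sum (fun i hi => hJ i (Finset.mem_of_mem_filter i hi))
        _ = (s.filter (fun i => Λ J < f i)).card * Λ (J + 1) := by
            rw [Finset.sum_const, nsmul_eq_mul]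
        _ ≤ c J * Λ (J + 1) := mul_le_mul_of_nonneg_right (hc J) (hΛ _)
    have h3 : ((s.filter (fun i => ¬ Λ J < f i)).card : ℝ) ≤ s.card := by
      exact_mod_cast Finset.card_le_card (Finset.filter_subset _ _)
    rw [← hsplit, Finset.sum_range_succ]
    nlinarith [hΛ 0]

/-- `∑_{j<J} 16^j ≤ 16^J / 15`. [folklore] -/
theorem sum_range_pow_le (J : ℕ) : ∑ j ∈ Finset.range J, (16 : ℝ) ^ j ≤ 16 ^ J / 15 := by
  induction J with
  | zero => norm_num
  | succ J ih => rw [Finset.sum_range_succ, pow_succ]; linarith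

/-- **The layer cake along the levels `Λ_j = 1 / sinh² (β (u₀/2^j)⁵)`.** If
`#{i : bᵢ sinh² (βu⁵) ≥ 1} ≤ K u⁶` for `0 < u ≤ u₀` and all `bᵢ ≤ Λ_J`, then
`∑ᵢ bᵢ ≤ n Λ₀ + (1024 K / (15 β² u₀⁴)) · 16^J`: with `u_j = u₀/2^j`, `t_j = β u_j⁵` one has
`#{Λ_j < bᵢ} ≤ K u_j⁶` and `Λ_{j+1} ≤ 1/t_{j+1}² = 1/(β² u_{j+1}¹⁰)` (`t ≤ sinh t`), so
`c_j Λ_{j+1} ≤ (1024 K / (β² u₀⁴)) 16^j`. [folklore] -/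
theorem sum_le_of_card_filter_le {n : ℕ} (b : Fin n → ℝ) {β u₀ K : ℝ} (hβ : 0 < β)
    (hu₀ : 0 < u₀) (hK : 0 ≤ K)
    (hcount : ∀ u : ℝ, 0 < u → u ≤ u₀ →
      ((Finset.univ.filter (fun i => 1 ≤ b i * Real.sinh (β * u ^ 5) ^ 2)).card : ℝ) ≤ K * u ^ 6)
    (J : ℕ) (hJ : ∀ i, b i ≤ 1 / Real.sinh (β * (u₀ / 2 ^ J) ^ 5) ^ 2) :
    ∑ i, b i ≤ n * (1 / Real.sinh (β * u₀ ^ 5) ^ 2) +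
      1024 * K / (15 * β ^ 2 * u₀ ^ 4) * 16 ^ J := by
  obtain ⟨Λ, hΛ⟩ : ∃ Λ : ℕ → ℝ, ∀ j, Λ j = 1 / Real.sinh (β * (u₀ / 2 ^ j) ^ 5) ^ 2 :=
    ⟨_, fun _ => rfl⟩
  obtain ⟨c, hc⟩ : ∃ c : ℕ → ℝ, ∀ j, c j = K * (u₀ / 2 ^ j) ^ 6 := ⟨_, fun _ => rfl⟩
  have hu : ∀ j : ℕ, 0 < u₀ / 2 ^ j := fun j => by positivity
  have hule : ∀ j : ℕ, u₀ / 2 ^ j ≤ u₀ := fun j =>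
    div_le_self hu₀.le (one_le_pow₀ (by norm_num))
  have ht : ∀ j : ℕ, 0 < β * (u₀ / 2 ^ j) ^ 5 := fun j => by positivity
  have hsh : ∀ j : ℕ, 0 < Real.sinh (β * (u₀ / 2 ^ j) ^ 5) := sinh_level_pos hβ hu₀
  have hΛ0 : ∀ j, 0 ≤ Λ j := fun j => by rw [hΛ]; positivity
  have hcj : ∀ j, ((Finset.univ.filter (fun i => Λ j < b i)).card : ℝ) ≤ c j := by
    intro j
    rw [hc]
    refine le_trans ?_ (hcount _ (hu j) (hule j))
    exact Nat.cast_le.2 (Finset.card_le_card (fun i hi => by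
      rw [Finset.mem_filter] at hi ⊢
      refine ⟨hi.1, ?_⟩
      have h2 := hi.2
      rw [hΛ] at h2
      exact ((div_lt_iff₀ (pow_pos (hsh j) 2)).1 h2).le))
  have hmain := sum_le_card_mul_add_sum_of_card_filter_le b Λ c hΛ0 J Finset.univ
    (fun j => hcj j) (fun i _ => by rw [hΛ]; exact hJ i)
  have hterm : ∀ j ∈ Finset.range J, c j * Λ (j + 1) ≤ 1024 * K / (β ^ 2 * u₀ ^ 4) * 16 ^ j := by
    intro j _
    have h1 : Λ (j + 1) ≤ 1 / (β * (u₀ / 2 ^ (j + 1)) ^ 5) ^ 2 := by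
      rw [hΛ]
      apply one_div_le_one_div_of_le (by positivity)
      exact pow_le_pow_left₀ (ht (j + 1)).le (Real.self_le_sinh_iff.2 (ht (j + 1)).le) 2
    have h2 : c j * (1 / (β * (u₀ / 2 ^ (j + 1)) ^ 5) ^ 2) =
        1024 * K / (β ^ 2 * u₀ ^ 4) * 16 ^ j := by
      rw [hc]
      have h16 : (16 : ℝ) ^ j = (2 ^ j) ^ 4 := by
        rw [← pow_mul, mul_comm, pow_mul]; norm_num
      rw [h16, pow_succ]
      field_simp
      ring
    calc c j * Λ (j + 1) ≤ c j * (1 / (β * (u₀ / 2 ^ (j + 1)) ^ 5) ^ 2) :=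
          mul_le_mul_of_nonneg_left h1 (by rw [hc]; positivity)
      _ = _ := h2
  calc ∑ i, b i ≤ (Finset.univ : Finset (Fin n)).card * Λ 0 +
        ∑ j ∈ Finset.range J, c j * Λ (j + 1) := hmain
    _ ≤ n * Λ 0 + ∑ j ∈ Finset.range J, 1024 * K / (β ^ 2 * u₀ ^ 4) * 16 ^ j := by
        rw [Finset.card_univ, Fintype.card_fin]
        exact add_le_add le_rfl (Finset.sum_le_sum hterm)
    _ = n * Λ 0 + 1024 * K / (β ^ 2 * u₀ ^ 4) * ∑ j ∈ Finset.range J, (16 : ℝ) ^ j := by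
        rw [Finset.mul_sum]
    _ ≤ n * Λ 0 + 1024 * K / (β ^ 2 * u₀ ^ 4) * (16 ^ J / 15) := by
        gcongr
        exact sum_range_pow_le J
    _ = _ := by rw [hΛ, pow_zero, div_one]; ring

/-- **Lower levels are small.** If `Λ_J = 1 / sinh² (β (u₀/2^J)⁵) < B` then
`1024^J < β² u₀¹⁰ cosh² (β u₀⁵) · B` (from `sinh t_J ≤ t_J cosh (βu₀⁵)` and
`t_J² = β² u₀¹⁰ / 1024^J`). [folklore] -/
theorem pow_lt_of_inv_sinh_sq_lt {β u₀ B : ℝ} (hβ : 0 < β) (hu₀ : 0 < u₀) (J : ℕ)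
    (hB : 1 / Real.sinh (β * (u₀ / 2 ^ J) ^ 5) ^ 2 < B) :
    (1024 : ℝ) ^ J < β ^ 2 * u₀ ^ 10 * Real.cosh (β * u₀ ^ 5) ^ 2 * B := by
  have hsh := sinh_level_pos hβ hu₀ J
  have h1 := sinh_level_le hβ hu₀ J
  obtain ⟨t, ht_def⟩ : ∃ t : ℝ, t = β * (u₀ / 2 ^ J) ^ 5 := ⟨_, rfl⟩
  rw [← ht_def] at hB hsh h1
  have h2 : Real.sinh t ^ 2 ≤ (t * Real.cosh (β * u₀ ^ 5)) ^ 2 := pow_le_pow_left₀ hsh.le h1 2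
  have h3 : 1 < B * Real.sinh t ^ 2 := (div_lt_iff₀ (pow_pos hsh 2)).1 hB
  have hBpos : 0 < B := by nlinarith [pow_pos hsh 2]
  have h4 : 1 < B * (t * Real.cosh (β * u₀ ^ 5)) ^ 2 :=
    lt_of_lt_of_le h3 (mul_le_mul_of_nonneg_left h2 hBpos.le)
  have h5 : (1024 : ℝ) ^ J = (2 ^ J) ^ 10 := by rw [← pow_mul, mul_comm, pow_mul]; norm_num
  have h6 : B * (t * Real.cosh (β * u₀ ^ 5)) ^ 2 * (2 ^ J) ^ 10 =
      β ^ 2 * u₀ ^ 10 * Real.cosh (β * u₀ ^ 5) ^ 2 * B := by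
    rw [ht_def]; field_simp
  rw [h5, ← h6]
  have h2J : (0 : ℝ) < (2 ^ J) ^ 10 := by positivity
  calc ((2 : ℝ) ^ J) ^ 10 = 1 * (2 ^ J) ^ 10 := (one_mul _).symm
    _ < B * (t * Real.cosh (β * u₀ ^ 5)) ^ 2 * (2 ^ J) ^ 10 := mul_lt_mul_of_pos_right h4 h2J

/-- **The levels exhaust.** Every `B` lies below some level `Λ_J = 1 / sinh² (β (u₀/2^J)⁵)`
(the levels increase to `+∞` since `sinh t_J ≤ t_J cosh (βu₀⁵) → 0`). [folklore] -/
theorem exists_le_inv_sinh_sq {β u₀ : ℝ} (hβ : 0 < β) (hu₀ : 0 < u₀) (B : ℝ) :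
    ∃ J : ℕ, B ≤ 1 / Real.sinh (β * (u₀ / 2 ^ J) ^ 5) ^ 2 := by
  obtain ⟨J, hJ⟩ := pow_unbounded_of_one_lt (β * u₀ ^ 5 * Real.cosh (β * u₀ ^ 5) * max 1 B)
    (by norm_num : (1 : ℝ) < 32)
  refine ⟨J, ?_⟩
  have hsh := sinh_level_pos hβ hu₀ J
  have h1 := sinh_level_le hβ hu₀ J
  obtain ⟨t, ht_def⟩ : ∃ t : ℝ, t = β * (u₀ / 2 ^ J) ^ 5 := ⟨_, rfl⟩
  rw [← ht_def] at hsh h1 ⊢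
  have ht : 0 < t := by rw [ht_def]; positivity
  have h32 : (32 : ℝ) ^ J = (2 ^ J) ^ 5 := by rw [← pow_mul, mul_comm, pow_mul]; norm_num
  have ht32 : t * 32 ^ J = β * u₀ ^ 5 := by rw [ht_def, h32]; field_simp
  have h32pos : (0 : ℝ) < 32 ^ J := by positivity
  have hkey : t * Real.cosh (β * u₀ ^ 5) * max 1 B < 1 := by
    have : t * Real.cosh (β * u₀ ^ 5) * max 1 B * 32 ^ J < 1 * 32 ^ J := by
      calc t * Real.cosh (β * u₀ ^ 5) * max 1 B * 32 ^ J
          = β * u₀ ^ 5 * Real.cosh (β * u₀ ^ 5) * max 1 B := by rw [← ht32]; ring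
        _ < 32 ^ J := hJ
        _ = 1 * 32 ^ J := (one_mul _).symm
    exact lt_of_mul_lt_mul_right this h32pos.le
  obtain ⟨y, hy_def⟩ : ∃ y : ℝ, y = t * Real.cosh (β * u₀ ^ 5) := ⟨_, rfl⟩
  rw [← hy_def] at hkey h1
  have hy : 0 ≤ y := by rw [hy_def]; positivity
  have hy1 : y ≤ 1 := by nlinarith [le_max_left 1 B]
  have hyB : y * B ≤ 1 := by nlinarith [le_max_right 1 B]
  rw [le_div_iff₀ (pow_pos hsh 2)]
  rcases le_or_gt B 0 with hB | hB
  · calc B * Real.sinh t ^ 2 ≤ 0 := mul_nonpos_of_nonpos_of_nonneg hB (sq_nonneg _)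
      _ ≤ 1 := zero_le_one
  · have hs2 : Real.sinh t ^ 2 ≤ y ^ 2 := pow_le_pow_left₀ hsh.le h1 2
    calc B * Real.sinh t ^ 2 ≤ B * y ^ 2 := mul_le_mul_of_nonneg_left hs2 hB.le
      _ = (y * B) * y := by ring
      _ ≤ 1 * 1 := mul_le_mul hyB hy1 hy zero_le_one
      _ = 1 := one_mul 1

/-! ### The first zero -/

/-- **The zero `θ = arcsin (B^{-1/2})`.** For `B ≥ 1` there is `θ > 0` with `B sin² θ = 1` and
`θ² B ≤ π²/4` (Jordan's inequality `(2/π) θ ≤ sin θ` on `[0, π/2]`). [folklore] -/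
theorem exists_pos_sin_sq_mul_eq_one {B : ℝ} (hB : 1 ≤ B) :
    ∃ θ : ℝ, 0 < θ ∧ θ ^ 2 * B ≤ Real.pi ^ 2 / 4 ∧ B * Real.sin θ ^ 2 = 1 := by
  have hBpos : 0 < B := by linarith
  have hsqrt : 0 < Real.sqrt B := Real.sqrt_pos.2 hBpos
  set x := 1 / Real.sqrt B with hx
  have hx0 : 0 < x := by positivity
  have hx1 : x ≤ 1 := by rw [hx, div_le_one hsqrt]; exact Real.one_le_sqrt.2 hB
  have hx2 : x ^ 2 = 1 / B := by rw [hx, div_pow, one_pow, Real.sq_sqrt hBpos.le]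
  have hsin : Real.sin (Real.arcsin x) = x := Real.sin_arcsin (by linarith) hx1
  refine ⟨Real.arcsin x, Real.arcsin_pos.2 hx0, ?_, ?_⟩
  · have hle : Real.arcsin x ≤ Real.pi / 2 := Real.arcsin_le_pi_div_two x
    have h0 : 0 ≤ Real.arcsin x := (Real.arcsin_pos.2 hx0).le
    have hJ := Real.mul_le_sin h0 hle
    rw [hsin] at hJ
    have hπ := Real.pi_pos
    have h2 : (2 / Real.pi * Real.arcsin x) ^ 2 ≤ x ^ 2 := pow_le_pow_left₀ (by positivity) hJ 2
    rw [hx2] at h2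
    have h3 : (2 / Real.pi * Real.arcsin x) ^ 2 * B ≤ 1 := by
      calc (2 / Real.pi * Real.arcsin x) ^ 2 * B ≤ 1 / B * B := by gcongr
        _ = 1 := by field_simp
    have h4 : (2 / Real.pi * Real.arcsin x) ^ 2 * B =
        (Real.arcsin x ^ 2 * B) * (4 / Real.pi ^ 2) := by
      ring
    rw [h4, ← le_div_iff₀ (by positivity)] at h3
    calc Real.arcsin x ^ 2 * B ≤ 1 / (4 / Real.pi ^ 2) := h3
      _ = Real.pi ^ 2 / 4 := by field_simp
  · rw [hsin, hx2]; field_simp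

end LeeYangZeroCounting

end Literature.Probability.LatticeModels
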